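import Literature.Analysis.DeBrangesSpaces.BurnolCosineKernelAnalyticContinuation
import Literature.Analysis.DeBrangesSpaces.BurnolCosineKernelClosedForm
import HarnessLib

/-!
# Burnol 2001 (CRAS 333), §1, proof of Thm. 1.5: the singular expansion of `∂_w^k C_λ(t,w)` at
# `t → 0⁺`

In the proof of Théorème 1.5 (TeX l.412–416) Burnol reads off the behaviour at the origin of the
functions `D_{w,k}(t) = (d^k/d^kw)C_λ(t,w)`: "`D_{w,k}(t)` a par le Lemme (1.3) une singularité
dominante pour `t → 0` du type `(log(1/t))^k t^{−w}`" (Lemme 1.3: "`C_a(u,w)` … est donc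
`γ₊(w)u^{−w} + O(1)` sur `]0,1]`").  We prove, for `a > 0`, every `k` and every `w`:

* `Re w ≤ 0` (`tendsto_rpow_mul_norm_iteratedDeriv_cosKernel`): `t^θ ‖∂_w^k C_a(t,w)‖ → 0` as
  `t → 0⁺` for every `θ > 0` (poly-logarithmic growth at most);
* `Re w > 0` (`exists_singular_expansion_iteratedDeriv_cosKernel`): there are constants `γ̃_0, …, γ̃_k`
  with `γ̃_0 = γ₊(w)` such that
  `∂_w^k C_a(t,w) = Σ_{j≤k} C(k,j)(−1)^j γ̃_{k−j} (log t)^j t^{−w} + R(t)`, `t^θ‖R(t)‖ → 0` for every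
  `θ > 0` — the dominant singularity is `γ₊(w)(log 1/t)^k t^{−w}`.

Route: the scaling formula `∂_w^k C_a(t,w) = t^{−w}Σ_i C(k,i)(−log t)^{k−i}∂_w^i C_{ta}(1,w)` and
`∂_w^i C_{ta}(1,w) = ∂_w^i C_a(1,w) + 2∫_{ta}^a cos(2πs)(log s)^i s^{w−1}ds`
(`BurnolCosineKernelAnalyticContinuation.lean`), the closed form (1.3) at `u = 1` for `γ̃_0 = γ₊(w)`
(`IsBurnolC.eq_closedForm`), and elementary estimates of `∫ |log s|^i s^{σ−1} ds` near `0`.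
RH-FREE (real analysis; `ζ` does not occur). bears_on: B-C/B-P (COLUMN 6 DBR) as tooling only.
WHAT THIS IS NOT: not a criterion, not a route; nothing here bears on the truth of RH.

## References
* [Burnol2001CRAS] J.-F. Burnol, C. R. Acad. Sci. Paris 333 (2001) 201–206, §1, Lemme 1.3
  (TeX l.358–364) and the proof of Théorème 1.5 (TeX l.409–416).
-/

open MeasureTheory Set Filter Complex Metric Finset
open scoped Real Topology

open Literature.Analysis.DeBrangesSpaces.SonineMellin (cosKernel differentiable_cosKernel
  cosKernel_eq_burnolC)

namespace Literature.Analysis.DeBrangesSpaces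

namespace Burnol2001

/-! ## A. Elementary estimates -/

/-- `‖cos(2πs)‖ ≤ 1` for real `s`. [folklore] -/
private theorem norm_ccos_real_le' (s : ℝ) : ‖Complex.cos (2 * π * s)‖ ≤ 1 := by
  rw [show (2 * π * s : ℂ) = ((2 * π * s : ℝ) : ℂ) by push_cast; ring, ← Complex.ofReal_cos,
    Complex.norm_real, Real.norm_eq_abs]
  exact Real.abs_cos_le_one _

/-- `|log t| ≤ (t^η + t^{−η})/η` for `t > 0`, `η > 0`. [folklore] -/
private theorem abs_log_le_rpow_add_rpow_div' {t η : ℝ} (ht : 0 < t) (hη : 0 < η) :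
    |Real.log t| ≤ (t ^ η + t ^ (-η)) / η := by
  have h1 : 0 ≤ t ^ η := Real.rpow_nonneg ht.le _
  have h2 : 0 ≤ t ^ (-η) := Real.rpow_nonneg ht.le _
  rcases le_or_gt 1 t with h | h
  · rw [abs_of_nonneg (Real.log_nonneg h)]
    calc Real.log t ≤ t ^ η / η := Real.log_le_rpow_div ht.le hη
      _ ≤ (t ^ η + t ^ (-η)) / η := by gcongr; linarith
  · rw [abs_of_neg (Real.log_neg ht h), ← Real.log_inv]
    calc Real.log t⁻¹ ≤ t⁻¹ ^ η / η := Real.log_le_rpow_div (inv_nonneg.2 ht.le) hη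
      _ = t ^ (-η) / η := by rw [Real.inv_rpow ht.le, Real.rpow_neg ht.le]
      _ ≤ (t ^ η + t ^ (-η)) / η := by gcongr; linarith

/-- On `(0, c]`: `|log s| ≤ ((c^{2η} + 1)/η) s^{−η}`. [folklore] -/
private theorem abs_log_le_const_mul_rpow_neg {s c η : ℝ} (hs : 0 < s) (hsc : s ≤ c) (hη : 0 < η) :
    |Real.log s| ≤ (c ^ (2 * η) + 1) / η * s ^ (-η) := by
  have h1 := abs_log_le_rpow_add_rpow_div' hs hη
  have h2 : s ^ η + s ^ (-η) = s ^ (-η) * (s ^ (2 * η) + 1) := by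
    rw [mul_add, mul_one, ← Real.rpow_add hs, show -η + 2 * η = η by ring]
  have h3 : s ^ (2 * η) ≤ c ^ (2 * η) := Real.rpow_le_rpow hs.le hsc (by linarith)
  have h4 : 0 ≤ s ^ (-η) := Real.rpow_nonneg hs.le _
  calc |Real.log s| ≤ (s ^ η + s ^ (-η)) / η := h1
    _ = s ^ (-η) * (s ^ (2 * η) + 1) / η := by rw [h2]
    _ ≤ s ^ (-η) * (c ^ (2 * η) + 1) / η := by gcongr
    _ = (c ^ (2 * η) + 1) / η * s ^ (-η) := by ring

/-- Near `0`: `‖cos(2πs)(log s)^i s^{w−1}‖ ≤ K^i s^{Re w − iη − 1}` on `(0,c]`, `K = (c^{2η}+1)/η`. [folklore] -/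
private theorem norm_cosLogPow_le_near_zero {s c η : ℝ} (hs : 0 < s) (hsc : s ≤ c) (hη : 0 < η)
    (i : ℕ) (w : ℂ) :
    ‖Complex.cos (2 * π * s) * Complex.log s ^ i * (s : ℂ) ^ (w - 1)‖ ≤
      ((c ^ (2 * η) + 1) / η) ^ i * s ^ (w.re - i * η - 1) := by
  set K : ℝ := (c ^ (2 * η) + 1) / η with hK
  have hc : 0 < c := hs.trans_le hsc
  have hK0 : 0 ≤ K := by positivity
  rw [norm_mul, norm_mul, norm_pow, ← Complex.ofReal_log hs.le, Complex.norm_real, Real.norm_eq_abs,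
    Complex.norm_cpow_eq_rpow_re_of_pos hs, Complex.sub_re, Complex.one_re]
  have h1 : |Real.log s| ^ i ≤ (K * s ^ (-η)) ^ i :=
    pow_le_pow_left₀ (abs_nonneg _) (abs_log_le_const_mul_rpow_neg hs hsc hη) i
  have h2 : (K * s ^ (-η)) ^ i = K ^ i * s ^ (-(i * η)) := by
    rw [mul_pow, ← Real.rpow_natCast (s ^ (-η)), ← Real.rpow_mul hs.le]
    congr 1; ring
  calc ‖Complex.cos (2 * π * s)‖ * |Real.log s| ^ i * s ^ (w.re - 1)
      ≤ 1 * (K ^ i * s ^ (-(i * η))) * s ^ (w.re - 1) :=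
        mul_le_mul (mul_le_mul (norm_ccos_real_le' s) (h1.trans_eq h2) (by positivity) zero_le_one)
          le_rfl (by positivity) (by positivity)
    _ = K ^ i * s ^ (w.re - i * η - 1) := by
        rw [one_mul, mul_assoc, ← Real.rpow_add hs]; congr 1; ring

/-- Continuity of `s ↦ cos(2πs)(log s)^i s^{w−1}` on `(0,∞)`. [folklore] -/
private theorem continuousOn_cosLogPow' (i : ℕ) (w : ℂ) :
    ContinuousOn (fun s : ℝ ↦ Complex.cos (2 * π * s) * Complex.log s ^ i * (s : ℂ) ^ (w - 1))
      (Ioi 0) := by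
  intro s hs
  have hs' : (s : ℂ) ∈ slitPlane := Complex.ofReal_mem_slitPlane.2 hs
  refine ContinuousAt.continuousWithinAt ?_
  refine (((Complex.continuous_cos.comp (continuous_const.mul Complex.continuous_ofReal)).continuousAt).mul
    ((ContinuousAt.comp (f := fun x : ℝ ↦ (x : ℂ)) (continuousAt_clog hs')
      Complex.continuous_ofReal.continuousAt).pow i)).mul ?_
  exact Complex.continuousAt_ofReal_cpow_const s (w - 1) (Or.inr (ne_of_gt hs))

/-- **Integrability at the origin**: for `Re w > iη`, `η > 0`, `s ↦ cos(2πs)(log s)^i s^{w−1}` is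
integrable on `(0, c]` (dominated by `K^i s^{Re w − iη − 1}`). [folklore] -/
private theorem integrableOn_cosLogPow_Ioc {c η : ℝ} (hη : 0 < η) (i : ℕ) {w : ℂ}
    (hσ : i * η < w.re) :
    IntegrableOn (fun s : ℝ ↦ Complex.cos (2 * π * s) * Complex.log s ^ i * (s : ℂ) ^ (w - 1))
      (Ioc 0 c) := by
  have hp : -1 < w.re - i * η - 1 := by linarith
  have hmaj : IntegrableOn (fun s : ℝ ↦ ((c ^ (2 * η) + 1) / η) ^ i * s ^ (w.re - i * η - 1))
      (Ioc 0 c) :=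
    ((intervalIntegral.intervalIntegrable_rpow' hp (a := 0) (b := c)).1).const_mul _
  refine hmaj.mono' ?_ ?_
  · exact ((continuousOn_cosLogPow' i w).mono fun s hs ↦ hs.1).aestronglyMeasurable measurableSet_Ioc
  · filter_upwards [ae_restrict_mem measurableSet_Ioc] with s hs
    exact norm_cosLogPow_le_near_zero hs.1 hs.2 hη i w

/-- Integrability at the origin for `Re w > 0` (choose `η` small). [folklore] -/
private theorem integrableOn_cosLogPow_Ioc' {c : ℝ} (i : ℕ) {w : ℂ} (hw : 0 < w.re) :
    IntegrableOn (fun s : ℝ ↦ Complex.cos (2 * π * s) * Complex.log s ^ i * (s : ℂ) ^ (w - 1))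
      (Ioc 0 c) := by
  have hη : 0 < w.re / (2 * (i + 1)) := by positivity
  refine integrableOn_cosLogPow_Ioc hη i ?_
  have h1 : (i : ℝ) * (w.re / (2 * (i + 1))) = w.re * (i / (2 * (i + 1))) := by ring
  have h2 : (i : ℝ) / (2 * (i + 1)) < 1 := by
    rw [div_lt_one (by positivity)]; linarith
  rw [h1]
  nlinarith

/-- **The size of the tail at the origin**: for `0 < b ≤ c`, `η > 0`, `Re w > iη`,
`‖∫_{(0,b]} cos(2πs)(log s)^i s^{w−1} ds‖ ≤ K^i b^{Re w − iη}/(Re w − iη)`, `K = (c^{2η}+1)/η`. [folklore] -/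
private theorem norm_setIntegral_cosLogPow_Ioc_le {b c η : ℝ} (hb : 0 < b) (hbc : b ≤ c) (hη : 0 < η)
    (i : ℕ) {w : ℂ} (hσ : i * η < w.re) :
    ‖∫ s in Ioc 0 b, Complex.cos (2 * π * s) * Complex.log s ^ i * (s : ℂ) ^ (w - 1)‖ ≤
      ((c ^ (2 * η) + 1) / η) ^ i * b ^ (w.re - i * η) / (w.re - i * η) := by
  set K : ℝ := (c ^ (2 * η) + 1) / η with hK
  set p : ℝ := w.re - i * η with hpdef
  have hp0 : 0 < p := by rw [hpdef]; linarith
  have hp : -1 < p - 1 := by linarith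
  have hmaj : IntegrableOn (fun s : ℝ ↦ K ^ i * s ^ (p - 1)) (Ioc 0 b) :=
    ((intervalIntegral.intervalIntegrable_rpow' hp (a := 0) (b := b)).1).const_mul _
  have h1 : ‖∫ s in Ioc 0 b, Complex.cos (2 * π * s) * Complex.log s ^ i * (s : ℂ) ^ (w - 1)‖ ≤
      ∫ s in Ioc 0 b, K ^ i * s ^ (p - 1) := by
    refine norm_integral_le_of_norm_le hmaj ?_
    filter_upwards [ae_restrict_mem measurableSet_Ioc] with s hs
    have := norm_cosLogPow_le_near_zero hs.1 (hs.2.trans hbc) hη i w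
    rwa [show w.re - i * η - 1 = p - 1 by rw [hpdef]] at this
  have h2 : ∫ s in Ioc 0 b, K ^ i * s ^ (p - 1) = K ^ i * b ^ p / p := by
    rw [integral_const_mul, ← intervalIntegral.integral_of_le hb.le, integral_rpow (Or.inl hp),
      sub_add_cancel, Real.zero_rpow hp0.ne', sub_zero, mul_div_assoc]
  exact h1.trans_eq h2

/-! ## B. The case `Re w ≤ 0`: poly-logarithmic growth -/

/-- For `Re w ≤ 0`, `0 < u ≤ 1`: `‖u^{−w} ∂_w^i C_{ua}(1,w)‖ ≤ ‖∂_w^i C_a(1,w)‖ +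
2a^{Re w}(|log u| + |log a|)^i |log u|` (from `∂_w^i C_{ua}(1,w) = ∂_w^i C_a(1,w) +
2∫_{ua}^a cos(2πs)(log s)^i s^{w−1}ds` and `s^{Re w − 1} ≤ (ua)^{Re w}s^{−1}` on `[ua, a]`).
[cite: Burnol2001CRAS, Lemme 1.3 (TeX l.358–364)] -/
theorem norm_cpow_mul_iteratedDeriv_cosKernel_le {a u : ℝ} (ha : 0 < a) (hu : 0 < u) (hu1 : u ≤ 1)
    (i : ℕ) {w : ℂ} (hw : w.re ≤ 0) :
    ‖(u : ℂ) ^ (-w) * iteratedDeriv i (cosKernel (u * a) 1) w‖ ≤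
      ‖iteratedDeriv i (cosKernel a 1) w‖ +
        2 * a ^ w.re * (|Real.log u| + |Real.log a|) ^ i * |Real.log u| := by
  have hua : 0 < u * a := mul_pos hu ha
  have hua_le : u * a ≤ a := by nlinarith
  set L : ℝ := |Real.log u| + |Real.log a| with hL
  set σ : ℝ := w.re with hσ
  -- `κ_i(ua) = κ_i(a) + 2∫_{ua}^a F_i`
  have hid := iteratedDeriv_cosKernel_one_sub hua ha i w
  have hκ : iteratedDeriv i (cosKernel (u * a) 1) w = iteratedDeriv i (cosKernel a 1) w +
      2 * ∫ s in (u * a)..a, Complex.cos (2 * π * s) * Complex.log s ^ i * (s : ℂ) ^ (w - 1) := by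
    linear_combination hid
  -- bound on the integral
  have hlog_u : |Real.log u| = -Real.log u := abs_of_nonpos (Real.log_nonpos hu.le hu1)
  have hbound : ∀ s ∈ Set.Ioc (u * a) a,
      ‖Complex.cos (2 * π * s) * Complex.log s ^ i * (s : ℂ) ^ (w - 1)‖ ≤ L ^ i * (u * a) ^ σ * s⁻¹ := by
    intro s hs
    have hs0 : 0 < s := hua.trans hs.1
    have hlogs : |Real.log s| ≤ L := by
      have h1 : Real.log (u * a) ≤ Real.log s := Real.log_le_log hua hs.1.le
      have h2 : Real.log s ≤ Real.log a := Real.log_le_log hs0 hs.2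
      rw [Real.log_mul hu.ne' ha.ne'] at h1
      rw [hL, abs_le]
      constructor
      · have := neg_abs_le (Real.log u); have := neg_abs_le (Real.log a); linarith
      · have := le_abs_self (Real.log a); have := abs_nonneg (Real.log u); linarith
    rw [norm_mul, norm_mul, norm_pow, ← Complex.ofReal_log hs0.le, Complex.norm_real,
      Real.norm_eq_abs, Complex.norm_cpow_eq_rpow_re_of_pos hs0, Complex.sub_re, Complex.one_re]
    have h3 : s ^ (σ - 1) = s ^ σ * s⁻¹ := by
      rw [Real.rpow_sub hs0, Real.rpow_one, div_eq_mul_inv]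
    have h4 : s ^ σ ≤ (u * a) ^ σ := Real.rpow_le_rpow_of_nonpos hua hs.1.le hw
    rw [← hσ, h3]
    have h5 : |Real.log s| ^ i ≤ L ^ i := pow_le_pow_left₀ (abs_nonneg _) hlogs i
    calc ‖Complex.cos (2 * π * s)‖ * |Real.log s| ^ i * (s ^ σ * s⁻¹)
        ≤ 1 * L ^ i * ((u * a) ^ σ * s⁻¹) :=
          mul_le_mul (mul_le_mul (norm_ccos_real_le' s) h5 (by positivity) zero_le_one)
            (mul_le_mul_of_nonneg_right h4 (inv_nonneg.2 hs0.le)) (by positivity) (by positivity)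
      _ = L ^ i * (u * a) ^ σ * s⁻¹ := by ring
  have hint_bound : IntervalIntegrable (fun s : ℝ ↦ L ^ i * (u * a) ^ σ * s⁻¹) volume (u * a) a := by
    refine (ContinuousOn.intervalIntegrable fun s hs ↦ ?_)
    have hs0 : s ≠ 0 := by
      rw [uIcc_of_le hua_le] at hs
      exact (hua.trans_le hs.1).ne'
    exact (continuousAt_const.mul (continuousAt_inv₀ hs0)).continuousWithinAt
  have hI : ‖∫ s in (u * a)..a, Complex.cos (2 * π * s) * Complex.log s ^ i * (s : ℂ) ^ (w - 1)‖ ≤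
      L ^ i * (u * a) ^ σ * |Real.log u| := by
    have h1 := intervalIntegral.norm_integral_le_of_norm_le hua_le
      (Eventually.of_forall fun s hs ↦ hbound s hs) hint_bound
    refine h1.trans_eq ?_
    have h0 : (0 : ℝ) ∉ uIcc (u * a) a := by
      rw [uIcc_of_le hua_le]; exact fun h ↦ (lt_irrefl _ (hua.trans_le h.1))
    rw [intervalIntegral.integral_const_mul, integral_inv h0, hlog_u]
    congr 1
    rw [show a / (u * a) = u⁻¹ by field_simp, Real.log_inv]
  -- assemble
  have hnorm_cpow : ‖(u : ℂ) ^ (-w)‖ = u ^ (-σ) := by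
    rw [Complex.norm_cpow_eq_rpow_re_of_pos hu, Complex.neg_re]
  have hu_le : u ^ (-σ) ≤ 1 := Real.rpow_le_one hu.le hu1 (by rw [hσ]; linarith)
  have hprod : u ^ (-σ) * (u * a) ^ σ = a ^ σ := by
    rw [Real.mul_rpow hu.le ha.le, ← mul_assoc, Real.rpow_neg hu.le,
      inv_mul_cancel₀ (Real.rpow_pos_of_pos hu σ).ne', one_mul]
  rw [norm_mul, hnorm_cpow, hκ]
  calc u ^ (-σ) * ‖iteratedDeriv i (cosKernel a 1) w +
        2 * ∫ s in (u * a)..a, Complex.cos (2 * π * s) * Complex.log s ^ i * (s : ℂ) ^ (w - 1)‖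
      ≤ u ^ (-σ) * (‖iteratedDeriv i (cosKernel a 1) w‖ + 2 * (L ^ i * (u * a) ^ σ * |Real.log u|)) := by
        refine mul_le_mul_of_nonneg_left ?_ (Real.rpow_nonneg hu.le _)
        refine (norm_add_le _ _).trans ?_
        rw [norm_mul, Complex.norm_ofNat]
        gcongr
    _ = u ^ (-σ) * ‖iteratedDeriv i (cosKernel a 1) w‖ +
          2 * (u ^ (-σ) * (u * a) ^ σ) * L ^ i * |Real.log u| := by ring
    _ ≤ 1 * ‖iteratedDeriv i (cosKernel a 1) w‖ + 2 * a ^ σ * L ^ i * |Real.log u| := by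
        rw [hprod]
        gcongr
    _ = ‖iteratedDeriv i (cosKernel a 1) w‖ + 2 * a ^ σ * L ^ i * |Real.log u| := by rw [one_mul]

/-- **Poly-logarithmic bound, `Re w ≤ 0`**: for `a > 0` there is `M` with
`‖∂_w^k C_a(u,w)‖ ≤ M (1 + |log u|)^{k+1}` for `0 < u ≤ 1`. [cite: Burnol2001CRAS, Lemme 1.3 and proof
of Théorème 1.5 (TeX l.358–364, 409–416)] -/
theorem exists_bound_iteratedDeriv_cosKernel_of_re_nonpos {a : ℝ} (ha : 0 < a) (k : ℕ) {w : ℂ}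
    (hw : w.re ≤ 0) : ∃ M : ℝ, ∀ u : ℝ, 0 < u → u ≤ 1 →
      ‖iteratedDeriv k (cosKernel a u) w‖ ≤ M * (1 + |Real.log u|) ^ (k + 1) := by
  set A : ℝ := 1 + |Real.log a| with hA
  set N : ℕ → ℝ := fun i ↦ ‖iteratedDeriv i (cosKernel a 1) w‖ with hN
  refine ⟨∑ i ∈ range (k + 1), (k.choose i : ℝ) * (N i + 2 * a ^ w.re * A ^ i), fun u hu hu1 ↦ ?_⟩
  set X : ℝ := 1 + |Real.log u| with hX
  have hX1 : 1 ≤ X := by rw [hX]; linarith [abs_nonneg (Real.log u)]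
  have hA1 : 1 ≤ A := by rw [hA]; linarith [abs_nonneg (Real.log a)]
  rw [iteratedDeriv_cosKernel_eq_sum ha hu k w, Finset.mul_sum, Finset.sum_mul]
  refine (norm_sum_le _ _).trans (Finset.sum_le_sum fun i hi ↦ ?_)
  have hik : i ≤ k := Nat.lt_succ_iff.1 (Finset.mem_range.1 hi)
  have h1 : ‖(u : ℂ) ^ (-w) * ((k.choose i : ℂ) * (-(Real.log u : ℂ)) ^ (k - i) *
      iteratedDeriv i (cosKernel (u * a) 1) w)‖ =
      (k.choose i : ℝ) * |Real.log u| ^ (k - i) *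
        ‖(u : ℂ) ^ (-w) * iteratedDeriv i (cosKernel (u * a) 1) w‖ := by
    rw [show (u : ℂ) ^ (-w) * ((k.choose i : ℂ) * (-(Real.log u : ℂ)) ^ (k - i) *
        iteratedDeriv i (cosKernel (u * a) 1) w) = ((k.choose i : ℂ) * (-(Real.log u : ℂ)) ^ (k - i)) *
        ((u : ℂ) ^ (-w) * iteratedDeriv i (cosKernel (u * a) 1) w) by ring]
    rw [norm_mul, norm_mul, norm_pow, norm_neg, Complex.norm_real, Real.norm_eq_abs, Complex.norm_natCast]
  rw [h1]
  have h2 := norm_cpow_mul_iteratedDeriv_cosKernel_le ha hu hu1 i hw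
  have hlogX : |Real.log u| ≤ X := by rw [hX]; linarith
  have hLX : |Real.log u| + |Real.log a| ≤ A * X := by
    rw [hA, hX]; nlinarith [abs_nonneg (Real.log u), abs_nonneg (Real.log a)]
  have h3 : ‖(u : ℂ) ^ (-w) * iteratedDeriv i (cosKernel (u * a) 1) w‖ ≤
      N i + 2 * a ^ w.re * (A * X) ^ i * X := by
    refine h2.trans ?_
    have : (|Real.log u| + |Real.log a|) ^ i ≤ (A * X) ^ i := pow_le_pow_left₀ (by positivity) hLX i
    have ha' : 0 ≤ 2 * a ^ w.re := by positivity
    change N i + _ ≤ N i + _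
    gcongr
  have h4 : |Real.log u| ^ (k - i) ≤ X ^ (k - i) := pow_le_pow_left₀ (abs_nonneg _) hlogX _
  calc (k.choose i : ℝ) * |Real.log u| ^ (k - i) * ‖(u : ℂ) ^ (-w) * iteratedDeriv i (cosKernel (u * a) 1) w‖
      ≤ (k.choose i : ℝ) * X ^ (k - i) * (N i + 2 * a ^ w.re * (A * X) ^ i * X) := by
        gcongr
    _ = (k.choose i : ℝ) * (N i * X ^ (k - i) + 2 * a ^ w.re * A ^ i * (X ^ (k - i) * X ^ i * X)) := by
        rw [mul_pow]; ring
    _ ≤ (k.choose i : ℝ) * (N i * X ^ (k + 1) + 2 * a ^ w.re * A ^ i * X ^ (k + 1)) := by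
        have e1 : X ^ (k - i) * X ^ i * X = X ^ (k + 1) := by
          rw [← pow_add, Nat.sub_add_cancel hik, pow_succ]
        rw [e1]
        have e2 : X ^ (k - i) ≤ X ^ (k + 1) := pow_le_pow_right₀ hX1 (by omega)
        have hN0 : 0 ≤ N i := norm_nonneg _
        gcongr
    _ = (k.choose i : ℝ) * (N i + 2 * a ^ w.re * A ^ i) * X ^ (k + 1) := by ring

/-! ## C. The case `Re w > 0`: the singular expansion -/

/-- `κ_i(ua) = γ̃_i − 2∫_{(0,ua]} F_i`, where `γ̃_i := ∂_w^i C_a(1,w) + 2∫_{(0,a]} cos(2πs)(log s)^i s^{w−1}ds`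
(`Re w > 0`, `u > 0`). [cite: Burnol2001CRAS, Lemme 1.3 (TeX l.358–364)] -/
private theorem iteratedDeriv_cosKernel_mul_eq {a u : ℝ} (ha : 0 < a) (hu : 0 < u) (i : ℕ) {w : ℂ}
    (hw : 0 < w.re) :
    iteratedDeriv i (cosKernel (u * a) 1) w =
      (iteratedDeriv i (cosKernel a 1) w +
        2 * ∫ s in Ioc 0 a, Complex.cos (2 * π * s) * Complex.log s ^ i * (s : ℂ) ^ (w - 1)) -
      2 * ∫ s in Ioc 0 (u * a), Complex.cos (2 * π * s) * Complex.log s ^ i * (s : ℂ) ^ (w - 1) := by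
  have hua : 0 < u * a := mul_pos hu ha
  have hid := iteratedDeriv_cosKernel_one_sub ha hua i w
  -- `∫_0^{ua} = ∫_0^a + ∫_a^{ua}`
  have h0a : IntervalIntegrable
      (fun s : ℝ ↦ Complex.cos (2 * π * s) * Complex.log s ^ i * (s : ℂ) ^ (w - 1)) volume 0 a :=
    (intervalIntegrable_iff_integrableOn_Ioc_of_le ha.le).2 (integrableOn_cosLogPow_Ioc' i hw)
  have haua : IntervalIntegrable
      (fun s : ℝ ↦ Complex.cos (2 * π * s) * Complex.log s ^ i * (s : ℂ) ^ (w - 1)) volume a (u * a) := by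
    refine ((continuousOn_cosLogPow' i w).mono fun s hs ↦ ?_).intervalIntegrable
    exact (lt_min ha hua).trans_le hs.1
  have hsplit := intervalIntegral.integral_add_adjacent_intervals h0a haua
  rw [intervalIntegral.integral_of_le ha.le, intervalIntegral.integral_of_le hua.le] at hsplit
  linear_combination -hid - 2 * hsplit

/-- `γ̃_0 = γ₊(w)`: the closed form (1.3) at `u = 1`, `C_a(1,w) = γ₊(w) − 2∫_0^a cos(2πs)s^{w−1}ds`.
[cite: Burnol2001CRAS, Lemme 1.3, eq. (1.3) (TeX l.352–362)] -/
private theorem cosKernel_one_add_integral_eq_gammaPlus {a : ℝ} (ha : 0 < a) {w : ℂ} (hw : 0 < w.re) :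
    iteratedDeriv 0 (cosKernel a 1) w +
        2 * ∫ s in Ioc 0 a, Complex.cos (2 * π * s) * Complex.log s ^ 0 * (s : ℂ) ^ (w - 1) =
      gammaPlus w := by
  have hBC : IsBurnolC a 1 (cosKernel a 1) :=
    ⟨differentiable_cosKernel ha one_ne_zero, fun z hz ↦ cosKernel_eq_burnolC ha one_ne_zero hz⟩
  have h := hBC.eq_closedForm ha one_pos hw
  rw [Complex.ofReal_one, Complex.one_cpow, mul_one] at h
  have hI : ∫ s in Ioc 0 a, Complex.cos (2 * π * s) * Complex.log s ^ 0 * (s : ℂ) ^ (w - 1) =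
      ∫ t in Ioc 0 a, ((Real.cos (2 * π * 1 * t) : ℝ) : ℂ) * (t : ℂ) ^ (w - 1) := by
    refine setIntegral_congr_fun measurableSet_Ioc (fun s _ ↦ ?_)
    rw [pow_zero, mul_one, Complex.ofReal_cos]
    congr 2
    push_cast; ring
  rw [iteratedDeriv_zero, hI, h]
  ring

/-- `u^θ (1 + |log u|)^n → 0` as `u → 0⁺`, for `θ > 0`. [folklore] -/
private theorem tendsto_rpow_mul_one_add_abs_log_pow (n : ℕ) {θ : ℝ} (hθ : 0 < θ) :
    Tendsto (fun u : ℝ ↦ u ^ θ * (1 + |Real.log u|) ^ n) (𝓝[>] (0 : ℝ)) (𝓝 0) := by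
  set ε : ℝ := θ / (n + 1) with hε
  have hε0 : 0 < ε := by positivity
  -- `u^ε → 0` and `u^ε |log u| → 0`
  have h1 : Tendsto (fun u : ℝ ↦ u ^ ε) (𝓝[>] (0 : ℝ)) (𝓝 0) := by
    have hc : ContinuousAt (fun u : ℝ ↦ u ^ ε) 0 := Real.continuousAt_rpow_const 0 ε (Or.inr hε0.le)
    have := hc.tendsto
    rw [Real.zero_rpow hε0.ne'] at this
    exact tendsto_nhdsWithin_of_tendsto_nhds this
  have h2 : Tendsto (fun u : ℝ ↦ u ^ ε * |Real.log u|) (𝓝[>] (0 : ℝ)) (𝓝 0) := by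
    have h := (tendsto_log_mul_rpow_nhdsGT_zero hε0).norm
    rw [norm_zero] at h
    refine h.congr' ?_
    filter_upwards [self_mem_nhdsWithin] with u hu
    rw [Real.norm_eq_abs, abs_mul, abs_of_nonneg (Real.rpow_nonneg (le_of_lt hu) _), mul_comm]
  have h3 : Tendsto (fun u : ℝ ↦ u ^ ε * (1 + |Real.log u|)) (𝓝[>] (0 : ℝ)) (𝓝 0) := by
    have := h1.add h2
    rw [add_zero] at this
    exact this.congr fun u ↦ by ring
  have h4 := h1.mul (h3.pow n)
  rw [zero_mul] at h4
  refine h4.congr' ?_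
  filter_upwards [self_mem_nhdsWithin] with u hu
  have hu' : 0 < u := hu
  rw [mul_pow, ← mul_assoc, ← Real.rpow_natCast (u ^ ε), ← Real.rpow_mul hu'.le,
    ← Real.rpow_add hu']
  congr 2
  rw [hε]; field_simp; ring

/-- **The singular expansion at the origin, `Re w > 0`** (Lemme 1.3: "`C_a(u,w)` … est donc
`γ₊(w)u^{−w} + O(1)` sur `]0,1]`"; proof of Théorème 1.5: "`D_{w,k}(t)` a … une singularité dominante
pour `t → 0` du type `(log(1/t))^k t^{−w}`", TeX l.362–364, 412–416): for `a > 0`, `Re w > 0`, `k ∈ ℕ`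
there are constants `γ̃_0, …, γ̃_k` with `γ̃_0 = γ₊(w)` and a remainder `R` with `t^θ‖R(t)‖ → 0`
(`t → 0⁺`) for every `θ > 0`, such that for all `t > 0`
`∂_w^k C_a(t,w) = Σ_{j≤k} C(k,j)(−1)^j γ̃_{k−j} (log t)^j t^{−w} + R(t)`.
[cite: Burnol2001CRAS, Lemme 1.3 and proof of Théorème 1.5 (TeX l.358–364, 412–416)] -/
theorem exists_singular_expansion_iteratedDeriv_cosKernel {a : ℝ} (ha : 0 < a) (k : ℕ) {w : ℂ}
    (hw : 0 < w.re) :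
    ∃ γt : ℕ → ℂ, γt 0 = gammaPlus w ∧ ∃ R : ℝ → ℂ,
      (∀ θ : ℝ, 0 < θ → Tendsto (fun t : ℝ ↦ t ^ θ * ‖R t‖) (𝓝[>] (0 : ℝ)) (𝓝 0)) ∧
      ∀ t : ℝ, 0 < t → iteratedDeriv k (cosKernel a t) w =
        ∑ j ∈ range (k + 1), (k.choose j : ℂ) * (-1) ^ j * γt (k - j) *
          ((Real.log t : ℝ) : ℂ) ^ j * ((t : ℝ) : ℂ) ^ (-w) + R t := by
  set σ : ℝ := w.re with hσ
  -- the constants `γ̃_i`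
  set γt : ℕ → ℂ := fun i ↦ iteratedDeriv i (cosKernel a 1) w +
    2 * ∫ s in Ioc 0 a, Complex.cos (2 * π * s) * Complex.log s ^ i * (s : ℂ) ^ (w - 1) with hγt
  -- the tails `ρ_i(t) = 2∫_{(0,ta]} F_i`
  set ρ : ℕ → ℝ → ℂ := fun i t ↦
    2 * ∫ s in Ioc 0 (t * a), Complex.cos (2 * π * s) * Complex.log s ^ i * (s : ℂ) ^ (w - 1) with hρ
  -- the singular part and the remainder
  set S : ℝ → ℂ := fun t ↦ ∑ j ∈ range (k + 1), (k.choose j : ℂ) * (-1) ^ j * γt (k - j) *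
    ((Real.log t : ℝ) : ℂ) ^ j * ((t : ℝ) : ℂ) ^ (-w) with hS
  set R : ℝ → ℂ := fun t ↦ iteratedDeriv k (cosKernel a t) w - S t with hR
  refine ⟨γt, cosKernel_one_add_integral_eq_gammaPlus ha hw, R, fun θ hθ ↦ ?_, fun t _ ↦ by
    rw [hR]; ring⟩
  -- the remainder in closed form: `R(t) = −t^{−w} Σ_i C(k,i)(−log t)^{k−i} ρ_i(t)`
  have hRform : ∀ t : ℝ, 0 < t → R t = -((t : ℂ) ^ (-w) *
      ∑ i ∈ range (k + 1), (k.choose i : ℂ) * (-(Real.log t : ℂ)) ^ (k - i) * ρ i t) := by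
    intro t ht
    have hexp := iteratedDeriv_cosKernel_eq_sum ha ht k w
    have hκ : ∀ i, iteratedDeriv i (cosKernel (t * a) 1) w = γt i - ρ i t := fun i ↦
      iteratedDeriv_cosKernel_mul_eq ha ht i hw
    simp_rw [hκ] at hexp
    -- reflect the singular sum: `j = k − i`
    have hrefl : S t =
        (t : ℂ) ^ (-w) * ∑ i ∈ range (k + 1), (k.choose i : ℂ) * (-(Real.log t : ℂ)) ^ (k - i) * γt i := by
      simp only [hS]
      rw [Finset.mul_sum, ← Finset.sum_range_reflect _ (k + 1)]
      refine Finset.sum_congr rfl fun i hi ↦ ?_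
      have hik : i ≤ k := Nat.lt_succ_iff.1 (Finset.mem_range.1 hi)
      simp only [add_tsub_cancel_right]
      rw [Nat.choose_symm hik, Nat.sub_sub_self hik, neg_pow]
      ring
    rw [hR]; dsimp only
    rw [hexp, hrefl, ← mul_sub, ← mul_neg, ← Finset.sum_sub_distrib, ← Finset.sum_neg_distrib]
    congr 1
    refine Finset.sum_congr rfl fun i _ ↦ ?_
    ring
  -- choose `η` with `kη < σ`, `kη ≤ θ/2`
  set η : ℝ := min σ θ / (2 * (k + 1)) with hηdef
  have hmin : 0 < min σ θ := lt_min hw hθ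
  have hη0 : 0 < η := by positivity
  have hkη : (k : ℝ) * η < min σ θ / 2 := by
    rw [hηdef]
    have hk : (k : ℝ) < k + 1 := by linarith
    have : (k : ℝ) * (min σ θ / (2 * (k + 1))) = (min σ θ / 2) * (k / (k + 1)) := by
      field_simp
    rw [this]
    have hlt : (k : ℝ) / (k + 1) < 1 := by rw [div_lt_one (by positivity)]; exact hk
    nlinarith
  have hkσ : ∀ i ∈ range (k + 1), (i : ℝ) * η < σ := by
    intro i hi
    have hik : (i : ℝ) ≤ k := by exact_mod_cast Nat.lt_succ_iff.1 (Finset.mem_range.1 hi)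
    have := min_le_left σ θ
    nlinarith
  -- the bound on `(0, t₀]`, `t₀ = min 1 a⁻¹`
  set K : ℝ := ((1 : ℝ) ^ (2 * η) + 1) / η with hK
  set M : ℝ := ∑ i ∈ range (k + 1),
    (k.choose i : ℝ) * (2 * (K ^ i * a ^ (σ - i * η) / (σ - i * η))) with hM
  have hbound : ∀ t : ℝ, 0 < t → t ≤ 1 → t * a ≤ 1 →
      ‖R t‖ ≤ M * (1 + |Real.log t|) ^ k * t ^ (-(k * η)) := by
    intro t ht ht1 hta
    set X : ℝ := 1 + |Real.log t| with hX
    have hX1 : 1 ≤ X := by rw [hX]; linarith [abs_nonneg (Real.log t)]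
    have hta0 : 0 < t * a := mul_pos ht ha
    have hterm : ∀ i ∈ range (k + 1),
        t ^ (-σ) * ‖(k.choose i : ℂ) * (-(Real.log t : ℂ)) ^ (k - i) * ρ i t‖ ≤
          (k.choose i : ℝ) * (2 * (K ^ i * a ^ (σ - i * η) / (σ - i * η))) * X ^ k * t ^ (-(k * η)) := by
      intro i hi
      have hik : i ≤ k := Nat.lt_succ_iff.1 (Finset.mem_range.1 hi)
      have hiη : (i : ℝ) * η < σ := hkσ i hi
      have hpos : 0 < σ - i * η := by linarith
      have hρ_le : ‖ρ i t‖ ≤ 2 * (K ^ i * (t * a) ^ (σ - i * η) / (σ - i * η)) := by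
        rw [hρ]; dsimp only
        rw [norm_mul, Complex.norm_ofNat]
        exact mul_le_mul_of_nonneg_left (norm_setIntegral_cosLogPow_Ioc_le hta0 hta hη0 i hiη) zero_le_two
      rw [norm_mul, norm_mul, norm_pow, norm_neg, Complex.norm_real, Real.norm_eq_abs, Complex.norm_natCast]
      have hlogX : |Real.log t| ^ (k - i) ≤ X ^ k :=
        (pow_le_pow_left₀ (abs_nonneg _) (by rw [hX]; linarith [abs_nonneg (Real.log t)]) _).trans
          (pow_le_pow_right₀ hX1 (Nat.sub_le k i))
      have hpow : t ^ (-σ) * (t * a) ^ (σ - i * η) = a ^ (σ - i * η) * t ^ (-(i * η)) := by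
        rw [Real.mul_rpow ht.le ha.le, ← mul_assoc, ← Real.rpow_add ht]
        rw [show -σ + (σ - i * η) = -(i * η) by ring]; ring
      have htpow : t ^ (-(i * η)) ≤ t ^ (-(k * η)) := by
        refine Real.rpow_le_rpow_of_exponent_ge ht ht1 ?_
        have : (i : ℝ) * η ≤ k * η := mul_le_mul_of_nonneg_right (by exact_mod_cast hik) hη0.le
        linarith
      have hKi : 0 ≤ K ^ i * a ^ (σ - i * η) / (σ - i * η) := by positivity
      have hC0 : 0 ≤ (k.choose i : ℝ) * (2 * (K ^ i * a ^ (σ - i * η) / (σ - i * η))) * X ^ k :=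
        mul_nonneg (mul_nonneg (Nat.cast_nonneg _) (mul_nonneg zero_le_two hKi)) (pow_nonneg (by positivity) _)
      calc t ^ (-σ) * ((k.choose i : ℝ) * |Real.log t| ^ (k - i) * ‖ρ i t‖)
          ≤ t ^ (-σ) * ((k.choose i : ℝ) * X ^ k * (2 * (K ^ i * (t * a) ^ (σ - i * η) / (σ - i * η)))) :=
            mul_le_mul_of_nonneg_left (mul_le_mul (mul_le_mul_of_nonneg_left hlogX (Nat.cast_nonneg _))
              hρ_le (norm_nonneg _) (by positivity)) (Real.rpow_nonneg ht.le _)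
      _ = (k.choose i : ℝ) * (2 * (K ^ i * (t ^ (-σ) * (t * a) ^ (σ - i * η)) / (σ - i * η))) * X ^ k := by
            ring
      _ = (k.choose i : ℝ) * (2 * (K ^ i * a ^ (σ - i * η) / (σ - i * η))) * X ^ k * t ^ (-(i * η)) := by
            rw [hpow]; ring
      _ ≤ (k.choose i : ℝ) * (2 * (K ^ i * a ^ (σ - i * η) / (σ - i * η))) * X ^ k * t ^ (-(k * η)) :=
            mul_le_mul_of_nonneg_left htpow hC0
    rw [hRform t ht, norm_neg, norm_mul, Complex.norm_cpow_eq_rpow_re_of_pos ht, Complex.neg_re, ← hσ]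
    calc t ^ (-σ) * ‖∑ i ∈ range (k + 1), (k.choose i : ℂ) * (-(Real.log t : ℂ)) ^ (k - i) * ρ i t‖
        ≤ t ^ (-σ) * ∑ i ∈ range (k + 1), ‖(k.choose i : ℂ) * (-(Real.log t : ℂ)) ^ (k - i) * ρ i t‖ :=
          mul_le_mul_of_nonneg_left (norm_sum_le _ _) (Real.rpow_nonneg ht.le _)
      _ = ∑ i ∈ range (k + 1), t ^ (-σ) * ‖(k.choose i : ℂ) * (-(Real.log t : ℂ)) ^ (k - i) * ρ i t‖ :=
          Finset.mul_sum _ _ _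
      _ ≤ ∑ i ∈ range (k + 1),
            (k.choose i : ℝ) * (2 * (K ^ i * a ^ (σ - i * η) / (σ - i * η))) * X ^ k * t ^ (-(k * η)) :=
          Finset.sum_le_sum hterm
      _ = M * X ^ k * t ^ (-(k * η)) := by rw [hM, Finset.sum_mul, Finset.sum_mul]
  -- conclusion: squeeze with `M (1+|log t|)^k t^{θ − kη} ≤ M (1+|log t|)^k t^{θ/2} → 0`
  have ht0 : 0 < min 1 a⁻¹ := lt_min one_pos (inv_pos.2 ha)
  have hlim : Tendsto (fun t : ℝ ↦ M * (t ^ (θ / 2) * (1 + |Real.log t|) ^ k)) (𝓝[>] (0 : ℝ)) (𝓝 0) := by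
    have := (tendsto_rpow_mul_one_add_abs_log_pow k (half_pos hθ)).const_mul M
    rwa [mul_zero] at this
  refine squeeze_zero_norm' ?_ hlim
  filter_upwards [Ioc_mem_nhdsGT ht0] with t ht
  have ht' : 0 < t := ht.1
  have ht1 : t ≤ 1 := ht.2.trans (min_le_left _ _)
  have hta : t * a ≤ 1 := by
    have : t ≤ a⁻¹ := ht.2.trans (min_le_right _ _)
    calc t * a ≤ a⁻¹ * a := mul_le_mul_of_nonneg_right this ha.le
      _ = 1 := inv_mul_cancel₀ ha.ne'
  rw [Real.norm_eq_abs, abs_mul, abs_of_nonneg (Real.rpow_nonneg ht'.le _), abs_norm]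
  have hM0 : 0 ≤ M := by
    rw [hM]
    refine Finset.sum_nonneg fun i hi ↦ ?_
    have : 0 < σ - i * η := by linarith [hkσ i hi]
    positivity
  calc t ^ θ * ‖R t‖ ≤ t ^ θ * (M * (1 + |Real.log t|) ^ k * t ^ (-(k * η))) :=
        mul_le_mul_of_nonneg_left (hbound t ht' ht1 hta) (Real.rpow_nonneg ht'.le _)
    _ = M * (t ^ (θ - k * η) * (1 + |Real.log t|) ^ k) := by
        rw [Real.rpow_sub ht', Real.rpow_neg ht'.le, div_eq_mul_inv]; ring
    _ ≤ M * (t ^ (θ / 2) * (1 + |Real.log t|) ^ k) := by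
        have h1 : t ^ (θ - k * η) ≤ t ^ (θ / 2) := by
          refine Real.rpow_le_rpow_of_exponent_ge ht' ht1 ?_
          have := min_le_right σ θ
          linarith
        have h2 : 0 ≤ (1 + |Real.log t|) ^ k := by positivity
        exact mul_le_mul_of_nonneg_left (mul_le_mul_of_nonneg_right h1 h2) hM0

/-- **Poly-logarithmic growth at the origin, `Re w ≤ 0`**: for `a > 0`, `Re w ≤ 0`, `k ∈ ℕ` and every
`θ > 0`, `t^θ ‖∂_w^k C_a(t,w)‖ → 0` as `t → 0⁺` (these terms carry no singularity of positive order: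
in the proof of Théorème 1.5 they are moved to `Re w ≥ 1/2` by the `𝓕₊`-symmetry instead,
TeX l.416–420). [cite: Burnol2001CRAS, Lemme 1.3 and proof of Théorème 1.5 (TeX l.358–364, 409–420)] -/
theorem tendsto_rpow_mul_norm_iteratedDeriv_cosKernel {a : ℝ} (ha : 0 < a) (k : ℕ) {w : ℂ}
    (hw : w.re ≤ 0) {θ : ℝ} (hθ : 0 < θ) :
    Tendsto (fun t : ℝ ↦ t ^ θ * ‖iteratedDeriv k (cosKernel a t) w‖) (𝓝[>] (0 : ℝ)) (𝓝 0) := by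
  obtain ⟨M, hM⟩ := exists_bound_iteratedDeriv_cosKernel_of_re_nonpos ha k hw
  have hlim : Tendsto (fun t : ℝ ↦ M * (t ^ θ * (1 + |Real.log t|) ^ (k + 1))) (𝓝[>] (0 : ℝ))
      (𝓝 0) := by
    have := (tendsto_rpow_mul_one_add_abs_log_pow (k + 1) hθ).const_mul M
    rwa [mul_zero] at this
  refine squeeze_zero_norm' ?_ hlim
  filter_upwards [Ioc_mem_nhdsGT one_pos] with t ht
  rw [Real.norm_eq_abs, abs_mul, abs_of_nonneg (Real.rpow_nonneg ht.1.le _), abs_norm]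
  calc t ^ θ * ‖iteratedDeriv k (cosKernel a t) w‖ ≤ t ^ θ * (M * (1 + |Real.log t|) ^ (k + 1)) :=
        mul_le_mul_of_nonneg_left (hM t ht.1 ht.2) (Real.rpow_nonneg ht.1.le _)
    _ = M * (t ^ θ * (1 + |Real.log t|) ^ (k + 1)) := by ring

end Burnol2001

end Literature.Analysis.DeBrangesSpaces
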